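import Mathlib
import HarnessLib
import Literature.Analysis.FluidPDE.VectorCalculus
import Literature.Analysis.FluidPDE.AxisymHouLiVariables
import Literature.Analysis.FluidPDE.CurlFreeLiouville
import Literature.Analysis.PDE.DivFormLiouville
import Summits.NavierStokesRegularity.NavierStokesRegularity.Theorems.PoloidalWindowDoorPoloidalWindowRigidityEllipticSlope

/-!
# Route `PoloidalWindowDoor`, crux `PoloidalWindowRigidity` (K2, stmt-NavierStokesRegularity-19708) —
# the elliptic-slope stratum is KINEMATICALLY empty: a Liouville theorem for bounded poloidal FIELDS

Cell ns-regularity-ideate, seat ns-poloidal-K2-p1 (K2 lead, gen 2; companion of `…EllipticSlope`, mechanism M11;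
`--supports stmt-…-19708 --as helper`).  After nsreg-p7 g5's remark (STATUS 2026-08-27T01:53Z): the proof of
`…EllipticSlope.eq_zero_of_ellipticShear` uses neither the Type-I rate nor the Oseen identity (M) nor the time variable — only
boundedness, `div = 0`, poloidality and the shear relation on ONE slice.  This file records the honest KINEMATIC form:

* `eq_const_of_ellipticShear_kinematic` — ANY bounded `C²` divergence-free field on `ℝ³`, poloidal along `e₂`, with
  `∂₂w_h = m ∇_h w₂`, `m(y) ∈ [μ₀, μ₁] ⊂ (0,∞)` pointwise, is CONSTANT (conditionally on the De Giorgi–Nash–Moser fact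
  `Literature.Analysis.PDE.divFormLiouville`): `w₂` is `a`-harmonic for `a = diag(m,m,1)` hence constant, then `∂₂w_h ≡ 0` by the
  shear relation, so `curl w ≡ 0`, and a bounded curl- and divergence-free field is constant (tree
  `eq_of_curl_eq_zero_of_isDivFree_of_bounded`).

So mechanism M11 sits with the vertically-rigid / flat / constant-slope strata: exclusions that hold for every bounded poloidal field,
independently of the Navier–Stokes dynamics.  What it says for the residue S2⁗ is unchanged (vorticity-dominated normal planes on
every slice), but the reason is kinematic, and no (M)-free witness can test it (refuter1's cellular/drift profiles have `Λ ≡ 1/2`,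
outside the stratum, as they must).

WHAT THIS IS NOT: not a claim about Navier–Stokes regularity and not the open residue — a conditional kinematic Liouville theorem
(bears_on LADDER-NS N0, rung N0-LocalTubeDoorPoloidal).
-/

noncomputable section

-- the summit and its single sub-problem share the name (CONVENTIONS §1), as in every Theorems file
set_option linter.dupNamespace false

namespace Summit.NavierStokesRegularity.NavierStokesRegularity.Theorems.PoloidalWindowDoorPoloidalWindowRigidityEllipticSlopeKinematic

open MeasureTheory Set Function Filter Topology
open scoped RealInnerProductSpace InnerProductSpace Matrix
open Literature.Analysis Literature.Analysis.FluidPDE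
open Summit.NavierStokesRegularity.NavierStokesRegularity.Theorems.PoloidalWindowDoorPoloidalWindowRigidityEllipticSlope

/-- **KINEMATIC LIOUVILLE FOR THE ELLIPTIC-SLOPE CLASS (conditionally on `divFormLiouville`).**  Let `w : ℝ³ → ℝ³` be ANY
bounded `C²` divergence-free field, poloidal along `e₂` (`(curl w)₂ ≡ 0`), whose vertical shear of the horizontal components is
at every point a multiple `m ∈ [μ₀, μ₁]` (`μ₀ > 0`) of the horizontal gradient of the vertical component (`∂₂w₀ = m ∂₀w₂`,
`∂₂w₁ = m ∂₁w₂`, `m` depending on the point).  Then `w` is CONSTANT.  Proof: `w₂` is a bounded `C¹` weak solution of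
`div(diag(m,m,1)∇w₂) = 0` (`integral_shear_weakForm`, `exists_measurable_shearRatio`), hence constant by De Giorgi–Nash–Moser; then
`∇w₂ ≡ 0`, so `∂₂w_h ≡ 0` by the shear relation, so `curl w ≡ 0`; a bounded curl- and divergence-free `C²` field on `ℝ³` is
constant (tree `eq_of_curl_eq_zero_of_isDivFree_of_bounded`).  So the stratum of `eq_zero_of_ellipticShear` is empty among ALL
bounded poloidal fields: mechanism M11 is KINEMATIC (it uses neither the Type-I rate nor the mild identity (M) nor the time
variable), exactly like the vertically-rigid and flat strata — the residue profile must have vorticity-dominated normal planes on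
every slice for a reason that has nothing to do with the dynamics. -/
theorem eq_const_of_ellipticShear_kinematic (hDGNM : Literature.Analysis.PDE.divFormLiouville)
    {w : EuclideanSpace ℝ (Fin 3) → EuclideanSpace ℝ (Fin 3)} (hw : ContDiff ℝ 2 w) {B : ℝ} (hbdd : ∀ y, ‖w y‖ ≤ B)
    (hdivw : VectorCalculus.IsDivFree w) (hpolw : ∀ y, curl w y 2 = 0)
    {μ₀ μ₁ : ℝ} (hμ₀ : 0 < μ₀)
    (hshear : ∀ y, ∃ m : ℝ, μ₀ ≤ m ∧ m ≤ μ₁ ∧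
      fderiv ℝ w y (EuclideanSpace.single 2 1) 0 = m * fderiv ℝ w y (EuclideanSpace.single 0 1) 2 ∧
      fderiv ℝ w y (EuclideanSpace.single 2 1) 1 = m * fderiv ℝ w y (EuclideanSpace.single 1 1) 2) :
    ∀ x y, w x = w y := by
  have hC1 : ContDiff ℝ 1 w := hw.of_le (by norm_num)
  have hd : Differentiable ℝ w := hC1.differentiable one_ne_zero
  obtain ⟨m, hmeas, hmbd, hmrel⟩ := exists_measurable_shearRatio hC1 hshear
  -- the coefficient field `a = diag(m, m, 1)` and its constants (as in `eq_zero_of_ellipticShear`)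
  set lam : ℝ := min μ₀ 1 with hlam
  set Λ : ℝ := max μ₁ 1 with hΛ
  have hlam0 : 0 < lam := lt_min hμ₀ one_pos
  set d : EuclideanSpace ℝ (Fin 3) → Fin 3 → ℝ := fun y => ![m y, m y, 1] with hd'
  have hdi : ∀ y i, lam ≤ d y i ∧ d y i ≤ Λ := by
    intro y i
    fin_cases i
    · exact hmbd y
    · exact hmbd y
    · exact ⟨min_le_right _ _, le_max_right _ _⟩
  set a : EuclideanSpace ℝ (Fin 3) → Matrix (Fin 3) (Fin 3) ℝ := fun y => Matrix.diagonal (d y) with ha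
  have hameas : ∀ i j, Measurable fun y => a y i j := by
    intro i j
    by_cases hij : i = j
    · subst hij
      simp only [ha, Matrix.diagonal_apply_eq]
      fin_cases i
      · simpa [hd'] using hmeas
      · simpa [hd'] using hmeas
      · simp [hd']
    · simp [ha, Matrix.diagonal_apply_ne _ hij]
  have hasymm : ∀ y, (a y).IsSymm := fun y => Matrix.isSymm_diagonal _
  have haell : ∀ y (ξ : Fin 3 → ℝ), lam * (ξ ⬝ᵥ ξ) ≤ ξ ⬝ᵥ (a y *ᵥ ξ) := by
    intro y ξ
    simp only [ha, Matrix.mulVec_diagonal, dotProduct, Finset.mul_sum]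
    refine Finset.sum_le_sum fun i _ => ?_
    have := (hdi y i).1
    nlinarith [mul_self_nonneg (ξ i)]
  have habd : ∀ y i j, |a y i j| ≤ Λ := by
    intro y i j
    have hΛ0 : 0 ≤ Λ := zero_le_one.trans (le_max_right _ _)
    by_cases hij : i = j
    · subst hij
      simp only [ha, Matrix.diagonal_apply_eq]
      rw [abs_of_nonneg (hlam0.le.trans (hdi y i).1)]
      exact (hdi y i).2
    · simpa [ha, Matrix.diagonal_apply_ne _ hij] using hΛ0
  -- the vertical component `u = w₂`: `C¹`, bounded, weak solution, hence constant
  set u : EuclideanSpace ℝ (Fin 3) → ℝ := fun y => w y 2 with hu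
  have huC1 : ContDiff ℝ 1 u := contDiff_apply_coord_vec3 hC1 2
  have hubdd : ∃ K : ℝ, ∀ y, |u y| ≤ K :=
    ⟨B, fun y => (PiLp.norm_apply_le (w y) 2).trans (hbdd y)⟩
  have hucoord : ∀ y (e : EuclideanSpace ℝ (Fin 3)), fderiv ℝ u y e = fderiv ℝ w y e 2 := fun y e =>
    fderiv_apply_coord_vec3 (hd y) 2 e
  have hweak : ∀ η : EuclideanSpace ℝ (Fin 3) → ℝ, ContDiff ℝ 1 η → HasCompactSupport η →
      ∫ y, ∑ i, ∑ j, a y i j * fderiv ℝ u y (EuclideanSpace.single i 1) *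
        fderiv ℝ η y (EuclideanSpace.single j 1) = 0 := by
    intro η hη hηc
    have hpt : ∀ y, ∑ i, ∑ j, a y i j * fderiv ℝ u y (EuclideanSpace.single i 1) *
        fderiv ℝ η y (EuclideanSpace.single j 1) =
        ∑ i : Fin 3, fderiv ℝ w y (EuclideanSpace.single 2 1) i * fderiv ℝ η y (EuclideanSpace.single i 1) := by
      intro y
      obtain ⟨h0, h1⟩ := hmrel y
      simp only [ha, hd', hucoord, Matrix.diagonal_apply, Fin.sum_univ_three]
      simp [h0, h1]
    simp_rw [hpt]
    exact integral_shear_weakForm hw hdivw hη hηc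
  have hconst := hDGNM 3 a lam Λ hlam0 hameas hasymm haell habd u huC1 hubdd hweak
  -- `∇w₂ ≡ 0`, hence `∂₂w_h ≡ 0` by the shear relation, hence `curl w ≡ 0`
  have hgrad2 : ∀ y (e : EuclideanSpace ℝ (Fin 3)), fderiv ℝ w y e 2 = 0 := by
    intro y e
    have hfun : u = fun _ => u 0 := funext fun x => hconst x 0
    rw [← hucoord, hfun]
    simp
  have hcurl : ∀ y, curl w y = 0 := by
    intro y
    obtain ⟨h0, h1⟩ := hmrel y
    have h20 : fderiv ℝ w y (EuclideanSpace.single 2 1) 0 = 0 := by rw [h0, hgrad2 y, mul_zero]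
    have h21 : fderiv ℝ w y (EuclideanSpace.single 2 1) 1 = 0 := by rw [h1, hgrad2 y, mul_zero]
    ext i
    fin_cases i
    · simp [curl, h21, hgrad2 y]
    · simp [curl, h20, hgrad2 y]
    · simpa using hpolw y
  exact eq_of_curl_eq_zero_of_isDivFree_of_bounded hw hcurl hdivw hbdd

end Summit.NavierStokesRegularity.NavierStokesRegularity.Theorems.PoloidalWindowDoorPoloidalWindowRigidityEllipticSlopeKinematic
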